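import Summits.HodgeConjecture.HodgeConjecture.Theorems.F0P3cStCharTSWeylHypTubeSigma   -- ★ (this seat) (J1) FILE 1 «TUBE-σ»: `exists_radialMeasure_tube`, `exists_isOpen_regular_wfree_nhds`, `restrict_eq_restrict_of_forall_isOpen`, `measure_eq_tsum_of_sUnion_eq`; brings ★ p851645 (B-jac) LOCAL
import HarnessLib

/-!
# F0 · P3c · line LH6 «StCharTS» — ROAD «JAC-LOC» brick (J1), FILE 2 «COSET REDUCTION»: the local tube-Jacobian socket of ★ p851645 FOLLOWS from its evaluation on
# OPEN sets ∕ on a DISJOINT COVERING FAMILY ∕ on a π-SYSTEM CONTAINING `U` (level cosets) near each regular point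
# (Harish-Chandra 1970 Lemma 22 ∕ 42; Rogawski 1990 §12.5 p. 182; Weil 1965 n° 49)

Cell `pub/hodgecm-mathlib`, crux H413 = `stmt-HodgeConjecture-24833` (lane `--supports`, helper); seat LH6-p04 (g6); brick (J1) of LH6-p03 (g5)'s ROAD «JAC-LOC»
(dealt 2026-09-02T14:11:30Z; road target: discharge `hJacLoc` of ★ p851645 for `D = |det(1 − Ad t)|_{𝔤∕𝔱}` by level-subgroup bookkeeping, bricks (J2)–(J6)).  THEOREMS
ONLY; sorry-free; no definition ∕ instance ∕ notation; axioms TRIO.  HONEST LABEL: count-neutral, closes no organ; HC_CM is proved only modulo the 7 printed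
citations (2 remaining: hLiu418 = `stmt-HodgeConjecture-24832`, h413 = `stmt-HodgeConjecture-24833`) until rung 0 closes.  (The road pays the HYPERBOLIC half
of the print residue «WIF» of the (S-𝔇) organ `stub_EllipticPackage` of `Cruxes/H413/Lines/F0_P3c_StCharTSPaydown.lean`.)

WHAT (chart-free measure theory; binders = ★ p851645 `lintegral_hypSet_eq_of_tubeJacobian_local` up to `hw` ∕ `hD` VERBATIM; `G = U(Φ₃)(L⁺_v)`, `T` the split
torus `(cmBorelTriple L 3 v).M`, `μ₀` the quotient measure on `G ⧸ T`, `Φ(q, t) = x t x⁻¹`, `Ω` the hyperbolic set, `w` the Weyl element):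
* (★ FILE 1 `…WeylHypTubeSigma.exists_radialMeasure_tube`: a measure `σ` on `T`, finite on compacts, carried by `T^{reg}`, with `ν(Φ(A × V)) = μ₀(A) · σ(V)` for every
  measurable `A` and every measurable regular `W`-free `V` — used throughout.)
* §2 **`tubeJacobianLocal_of_open`** — the socket `hJacLoc` of ★ p851645 (∀ regular `t₀` ∃ open `U ∋ t₀` ∃ `A₀` with the tube identity for every measurable regular
  `W`-free `V ⊆ U`) FOLLOWS from the same identity asked ONLY FOR OPEN `O ⊆ U`: shrink `U` into a compact, `W`-free, regular neighbourhood `U′` (★ p849811 §e: `w t₀ w⁻¹ ≠ t₀`),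
  read `σ(O) = ∫⁻_O D dtm` for open `O ⊆ U′` off §1, and conclude `σ|_{U′} = (D · tm)|_{U′}` by uniqueness of finite Borel measures agreeing on open sets
  (`ext_of_generate_finite`, `isPiSystem_isOpen`).
* §3 **`tubeJacobianLocal_of_cover`** — the socket FOLLOWS from the identity on an arbitrary family `𝒞` of measurable subsets of `U` such that every open `O ⊆ U` is a
  countable union of pairwise DISJOINT members of `𝒞` (the shape the level-coset computation (J4)–(J6) delivers: `𝒞 = {s·T_j}`, cosets of the congruence filtration
  — two cosets are nested or disjoint, and every open set of the locally profinite `T` is a countable disjoint union of them): σ-additivity of `σ` (§1) and of `D · tm`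
  on the disjoint cover reduces to §2.
* §4 **`tubeJacobianLocal_of_piSystem`** — the socket FOLLOWS from the identity on a π-system `𝒞` of measurable subsets of a relatively compact, regular, `W`-free open
  `U ∋ t₀` WITH `U ∈ 𝒞` whose generated σ-algebra contains the open subsets of `U` (the memo's wording: «the cosets `s′T_γ′ ⊆ U` form a π-system generating Borel(`U`)»;
  (J6) takes `U = t₀·T_γ` inside ★ `exists_isOpen_regular_wfree_nhds`): `ext_on_measurableSpace_of_generate_finite` + `measurableSet_generateFrom_inter_of_open`.

## References
* [HarishChandra1970] Harish-Chandra, *Harmonic analysis on reductive p-adic groups*, LNM 162 (1970), Lemma 22 (Jacobian of conjugation), Lemma 42 (Weyl integration).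
* [Rogawski1990] J. D. Rogawski, *Automorphic Representations of Unitary Groups in Three Variables*, Ann. of Math. Stud. 123 (1990), §12.5 p. 182.
* [vanDijk1972] G. van Dijk, *Computation of certain induced characters of p-adic groups*, Math. Ann. 199 (1972) 229–240, §2.
* [Weil1965] A. Weil, *Sur la formule de Siegel dans la théorie des groupes classiques*, Acta Math. 113 (1965), n° 49 Lemme 22 (p. 70).
-/

set_option autoImplicit false
set_option linter.dupNamespace false

noncomputable section

open MeasureTheory Measure Set Filter Topology Function NumberField IsDedekindDomain Matrix Polynomial
open Literature.MeasureTheory.Group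
open Literature.NumberTheory.Automorphic Literature.NumberTheory.Automorphic.UnitaryGroup Literature.NumberTheory.Rogawski1990
open Summit.HodgeConjecture.HodgeConjecture.Cruxes.H413.F0P3cStCharTSWeylHypFibre
open Summit.HodgeConjecture.HodgeConjecture.Cruxes.H413.F0P3cStCharTSWeylHypNormaliser
open Summit.HodgeConjecture.HodgeConjecture.Cruxes.H413.F0P3cStCharTSWeylHypTorsor
open Summit.HodgeConjecture.HodgeConjecture.Cruxes.H413.F0P3cStCharTSWeylHypCM
open Summit.HodgeConjecture.HodgeConjecture.Cruxes.H413.F0P3cStCharTSWeylHypMeasure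
open Summit.HodgeConjecture.HodgeConjecture.Cruxes.H413.F0P3cStCharTSWeylHypJacobian
open scoped ENNReal NNReal MatrixGroups Pointwise

namespace Summit.HodgeConjecture.HodgeConjecture.Cruxes.H413.F0P3cStCharTSWeylHypTubeReduction

open Summit.HodgeConjecture.HodgeConjecture.Cruxes.H413.F0P3cStCharTSWeylHypTubeSigma

/-! ## §1 Borel traces on `U` lie in any σ-algebra containing the open subsets of `U` -/
/-- **Borel traces on `U` are generated by a family generating the open subsets of `U`**: if every open `O ⊆ U` (in particular `U`) is measurable for the σ-algebra
`m` generated by `𝒞`, then so is `B ∩ U` for every Borel `B` (induction over open ∕ complement ∕ countable union, `MeasurableSet.induction_on_open`). [folklore] -/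
theorem measurableSet_generateFrom_inter_of_open {α : Type*} [TopologicalSpace α] [MeasurableSpace α] [BorelSpace α] {U : Set α} (hUo : IsOpen U)
    (𝒞 : Set (Set α)) (hopen : ∀ O : Set α, IsOpen O → O ⊆ U → MeasurableSet[MeasurableSpace.generateFrom 𝒞] O)
    {B : Set α} (hB : MeasurableSet B) : MeasurableSet[MeasurableSpace.generateFrom 𝒞] (B ∩ U) := by
  induction B, hB using MeasurableSet.induction_on_open with
  | isOpen O hO => exact hopen (O ∩ U) (hO.inter hUo) inter_subset_right
  | compl B hB ih =>
    have hU : MeasurableSet[MeasurableSpace.generateFrom 𝒞] U := hopen U hUo subset_rfl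
    have heq : Bᶜ ∩ U = U \ (B ∩ U) := by
      ext x; constructor
      · rintro ⟨hx, hxU⟩; exact ⟨hxU, fun h => hx h.1⟩
      · rintro ⟨hxU, hx⟩; exact ⟨fun h => hx ⟨h, hxU⟩, hxU⟩
    rw [heq]
    exact hU.diff ih
  | iUnion f _ hf ih =>
    rw [iUnion_inter]
    exact MeasurableSet.iUnion ih


section CM

variable (L : Type) [Field L] [NumberField L] [IsCMField L] (v : HeightOneSpectrum (𝓞 ↥(maximalRealSubfield L)))

/-! ## §2 The local socket from its OPEN form -/

set_option maxHeartbeats 3200000 in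
set_option synthInstance.maxHeartbeats 200000 in
-- as §1
/-- **(J1)(b) «COSET REDUCTION», open form**: the local tube-Jacobian socket `hJacLoc` of ★ p851645 `lintegral_hypSet_eq_of_tubeJacobian_local` (its binder
VERBATIM) FOLLOWS from the tube identity `ν(Φ(A₀ × O)) = μ₀(A₀) · ∫⁻_O D dtm` asked only for the OPEN subsets `O` of the neighbourhood `U` of `t₀`.  Proof: shrink
`U` to a `W`-free (★ p849811 §e: `w t₀ w⁻¹ ≠ t₀`), regular (`T^{reg}` is open), relatively compact open `U′ ∋ t₀`; by §1 the identity reads `σ(O) = ∫⁻_O D dtm`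
for open `O ⊆ U′` (`μ₀(A₀) ≠ 0, ∞` cancels); two Borel measures finite on `U′` agreeing on its open subsets agree on `U′` (§0); then §1 again for an arbitrary
measurable regular `W`-free `V ⊆ U′`. [cite: HarishChandra1970, Lemma 22] [cite: Weil1965, n° 49 Lemme 22 (p. 70)] [cite: Rogawski1990, §12.5 p. 182] -/
theorem tubeJacobianLocal_of_open
    (hns : ∀ w : PlacesOver L v, IsCMField.complexConj L • w.1 = w.1)
    [MeasurableSpace ↥(unitaryGroupOfForm (conjLocal L (IsCMField.complexConj L) v) (cmLocalForm L 3 v))] [BorelSpace ↥(unitaryGroupOfForm (conjLocal L (IsCMField.complexConj L) v) (cmLocalForm L 3 v))] [LocallyCompactSpace ↥(unitaryGroupOfForm (conjLocal L (IsCMField.complexConj L) v) (cmLocalForm L 3 v))] [SecondCountableTopology ↥(unitaryGroupOfForm (conjLocal L (IsCMField.complexConj L) v) (cmLocalForm L 3 v))] [T2Space ↥(unitaryGroupOfForm (conjLocal L (IsCMField.complexConj L) v) (cmLocalForm L 3 v))]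
    [MeasurableSpace (↥(unitaryGroupOfForm (conjLocal L (IsCMField.complexConj L) v) (cmLocalForm L 3 v)) ⧸ (cmBorelTriple L 3 v).M)] [BorelSpace (↥(unitaryGroupOfForm (conjLocal L (IsCMField.complexConj L) v) (cmLocalForm L 3 v)) ⧸ (cmBorelTriple L 3 v).M)]
    (ν : Measure ↥(unitaryGroupOfForm (conjLocal L (IsCMField.complexConj L) v) (cmLocalForm L 3 v))) [ν.IsHaarMeasure] [ν.IsMulRightInvariant]
    (tm : Measure ↥(cmBorelTriple L 3 v).M) [tm.IsMulLeftInvariant] [IsFiniteMeasureOnCompacts tm] [tm.IsOpenPosMeasure] [tm.IsInvInvariant]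
    (Φ : (↥(unitaryGroupOfForm (conjLocal L (IsCMField.complexConj L) v) (cmLocalForm L 3 v)) ⧸ (cmBorelTriple L 3 v).M) × ↥(cmBorelTriple L 3 v).M → ↥(unitaryGroupOfForm (conjLocal L (IsCMField.complexConj L) v) (cmLocalForm L 3 v))) (hΦ : ∀ (x : ↥(unitaryGroupOfForm (conjLocal L (IsCMField.complexConj L) v) (cmLocalForm L 3 v))) (t : ↥(cmBorelTriple L 3 v).M), Φ (QuotientGroup.mk x, t) = x * t * x⁻¹)
    (w : ↥(unitaryGroupOfForm (conjLocal L (IsCMField.complexConj L) v) (cmLocalForm L 3 v))) (hw : Units.val (w : GL (Fin 3) (LocalRing L v)) = cmLocalForm L 3 v)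
    (D : ↥(cmBorelTriple L 3 v).M → ℝ≥0)
    (hJacOpen : ∀ t₀ : ↥(cmBorelTriple L 3 v).M, IsRegularElt (((t₀ : ↥(unitaryGroupOfForm (conjLocal L (IsCMField.complexConj L) v) (cmLocalForm L 3 v)))) : GL (Fin 3) (LocalRing L v)) →
      ∃ U : Set ↥(cmBorelTriple L 3 v).M, IsOpen U ∧ t₀ ∈ U ∧
        ∃ A₀ : Set (↥(unitaryGroupOfForm (conjLocal L (IsCMField.complexConj L) v) (cmLocalForm L 3 v)) ⧸ (cmBorelTriple L 3 v).M), MeasurableSet A₀ ∧ (quotientMeasure (cmBorelTriple L 3 v).M tm (isClosed_cmBorelTriple_M L v) ν) A₀ ≠ 0 ∧ (quotientMeasure (cmBorelTriple L 3 v).M tm (isClosed_cmBorelTriple_M L v) ν) A₀ ≠ ∞ ∧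
          ∀ O : Set ↥(cmBorelTriple L 3 v).M, IsOpen O → O ⊆ U →
            ν (Φ '' (A₀ ×ˢ O)) = (quotientMeasure (cmBorelTriple L 3 v).M tm (isClosed_cmBorelTriple_M L v) ν) A₀ * ∫⁻ t in O, (D t : ℝ≥0∞) ∂tm) :
    ∀ t₀ : ↥(cmBorelTriple L 3 v).M, IsRegularElt (((t₀ : ↥(unitaryGroupOfForm (conjLocal L (IsCMField.complexConj L) v) (cmLocalForm L 3 v)))) : GL (Fin 3) (LocalRing L v)) →
      ∃ U : Set ↥(cmBorelTriple L 3 v).M, IsOpen U ∧ t₀ ∈ U ∧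
        ∃ A₀ : Set (↥(unitaryGroupOfForm (conjLocal L (IsCMField.complexConj L) v) (cmLocalForm L 3 v)) ⧸ (cmBorelTriple L 3 v).M), MeasurableSet A₀ ∧ (quotientMeasure (cmBorelTriple L 3 v).M tm (isClosed_cmBorelTriple_M L v) ν) A₀ ≠ 0 ∧ (quotientMeasure (cmBorelTriple L 3 v).M tm (isClosed_cmBorelTriple_M L v) ν) A₀ ≠ ∞ ∧
          ∀ V : Set ↥(cmBorelTriple L 3 v).M, MeasurableSet V → V ⊆ U → (∀ t ∈ V, IsRegularElt (((t : ↥(unitaryGroupOfForm (conjLocal L (IsCMField.complexConj L) v) (cmLocalForm L 3 v)))) : GL (Fin 3) (LocalRing L v))) →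
            (∀ t ∈ V, ∀ t' ∈ V, ((t' : ↥(cmBorelTriple L 3 v).M) : ↥(unitaryGroupOfForm (conjLocal L (IsCMField.complexConj L) v) (cmLocalForm L 3 v))) ≠ w * t * w⁻¹) →
              ν (Φ '' (A₀ ×ˢ V)) = (quotientMeasure (cmBorelTriple L 3 v).M tm (isClosed_cmBorelTriple_M L v) ν) A₀ * ∫⁻ t in V, (D t : ℝ≥0∞) ∂tm := by
  classical
  obtain ⟨σ, hσfin, hσsf, hσcar, -, htube⟩ := exists_radialMeasure_tube L v hns ν tm Φ hΦ w hw
  haveI := hσfin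
  -- carrier data for the `W`-free neighbourhood (★ p849811 §e)
  haveI : Nontrivial (LocalRing L v) := UnitaryGroup.nontrivial_localRing L v
  have hR : ∀ x : LocalRing L v, x ≠ 0 → IsUnit x := isUnit_of_ne_zero_of_nonsplit L v hns
  have hJ : cmLocalForm L 3 v = (StdForm.antidiagonal 3).over (LocalRing L v) := cmLocalForm_eq_over L 3 v
  have hT := isClosed_cmBorelTriple_M L v
  have hSo : IsOpen {t : ↥(cmBorelTriple L 3 v).M | IsRegularElt (((t : ↥(unitaryGroupOfForm (conjLocal L (IsCMField.complexConj L) v) (cmLocalForm L 3 v)))) : GL (Fin 3) (LocalRing L v))} :=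
    isOpen_setOf_isRegularElt_torusU (conjLocal L (IsCMField.complexConj L) v) (cmLocalForm L 3 v) hR
  haveI : LocallyCompactSpace ↥(cmBorelTriple L 3 v).M := hT.isClosedEmbedding_subtypeVal.locallyCompactSpace
  intro t₀ ht₀
  obtain ⟨U, hUo, ht₀U, A₀, hA₀m, hA₀0, hA₀top, hopen⟩ := hJacOpen t₀ ht₀
  -- a `W`-free open neighbourhood of `t₀`
  have hne : (t₀ : ↥(unitaryGroupOfForm (conjLocal L (IsCMField.complexConj L) v) (cmLocalForm L 3 v))) ≠ w * t₀ * w⁻¹ := by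
    intro h
    apply weyl_not_mem_torusU (conjLocal L (IsCMField.complexConj L) v) hJ hw
    have hwZ : w ∈ Subgroup.centralizer ({(t₀ : ↥(unitaryGroupOfForm (conjLocal L (IsCMField.complexConj L) v) (cmLocalForm L 3 v)))} : Set ↥(unitaryGroupOfForm (conjLocal L (IsCMField.complexConj L) v) (cmLocalForm L 3 v))) := by
      rw [Subgroup.mem_centralizer_iff]
      intro g hg
      rw [mem_singleton_iff.1 hg]
      exact (mul_inv_eq_iff_eq_mul.1 h.symm).symm
    rw [centralizer_eq_cmTorus_of_isRegularElt L v t₀.2 ht₀] at hwZ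
    exact hwZ
  obtain ⟨O₁, O₂, hO₁, hO₂, h₁, h₂, hdisj⟩ := t2_separation hne
  have hcont : Continuous fun t : ↥(cmBorelTriple L 3 v).M => w * (t : ↥(unitaryGroupOfForm (conjLocal L (IsCMField.complexConj L) v) (cmLocalForm L 3 v))) * w⁻¹ := (continuous_const.mul continuous_subtype_val).mul continuous_const
  -- a compact neighbourhood of `t₀`
  obtain ⟨K, hKc, hKt₀⟩ := exists_compact_mem_nhds t₀
  -- the shrunken neighbourhood `U′`
  set U' : Set ↥(cmBorelTriple L 3 v).M := U ∩ ({t | (t : ↥(unitaryGroupOfForm (conjLocal L (IsCMField.complexConj L) v) (cmLocalForm L 3 v))) ∈ O₁ ∧ w * (t : ↥(unitaryGroupOfForm (conjLocal L (IsCMField.complexConj L) v) (cmLocalForm L 3 v))) * w⁻¹ ∈ O₂} ∩ ({t : ↥(cmBorelTriple L 3 v).M | IsRegularElt (((t : ↥(unitaryGroupOfForm (conjLocal L (IsCMField.complexConj L) v) (cmLocalForm L 3 v)))) : GL (Fin 3) (LocalRing L v))} ∩ interior K)) with hU'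
  have hWo : IsOpen {t : ↥(cmBorelTriple L 3 v).M | (t : ↥(unitaryGroupOfForm (conjLocal L (IsCMField.complexConj L) v) (cmLocalForm L 3 v))) ∈ O₁ ∧ w * (t : ↥(unitaryGroupOfForm (conjLocal L (IsCMField.complexConj L) v) (cmLocalForm L 3 v))) * w⁻¹ ∈ O₂} := (hO₁.preimage continuous_subtype_val).inter (hO₂.preimage hcont)
  have hU'o : IsOpen U' := hUo.inter (hWo.inter (hSo.inter isOpen_interior))
  have ht₀U' : t₀ ∈ U' := ⟨ht₀U, ⟨h₁, h₂⟩, ht₀, mem_interior_iff_mem_nhds.2 hKt₀⟩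
  have hU'U : U' ⊆ U := fun t ht => ht.1
  have hU'reg : ∀ t ∈ U', IsRegularElt (((t : ↥(unitaryGroupOfForm (conjLocal L (IsCMField.complexConj L) v) (cmLocalForm L 3 v)))) : GL (Fin 3) (LocalRing L v)) := fun t ht => ht.2.2.1
  have hU'free : ∀ t ∈ U', ∀ t' ∈ U', ((t' : ↥(cmBorelTriple L 3 v).M) : ↥(unitaryGroupOfForm (conjLocal L (IsCMField.complexConj L) v) (cmLocalForm L 3 v))) ≠ w * t * w⁻¹ := fun t ht t' ht' h => hdisj.ne_of_mem ht'.2.1.1 ht.2.1.2 h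
  have hU'K : U' ⊆ K := fun t ht => interior_subset ht.2.2.2
  have hσU' : σ U' ≠ ∞ := ((measure_mono hU'K).trans_lt hKc.measure_lt_top).ne
  -- `σ = D · tm` on the open subsets of `U′`, hence on `U′`
  have hopen' : ∀ O : Set ↥(cmBorelTriple L 3 v).M, IsOpen O → σ (O ∩ U') = (tm.withDensity fun t => (D t : ℝ≥0∞)) (O ∩ U') := by
    intro O hO
    have hOU'o : IsOpen (O ∩ U') := hO.inter hU'o
    have h1 := htube A₀ hA₀m (O ∩ U') hOU'o.measurableSet (fun t ht => hU'reg t ht.2) (fun t ht t' ht' => hU'free t ht.2 t' ht'.2)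
    have h2 := hopen (O ∩ U') hOU'o fun t ht => hU'U ht.2
    rw [h1] at h2
    rw [withDensity_apply _ hOU'o.measurableSet]
    exact (ENNReal.mul_right_inj hA₀0 hA₀top).1 h2
  have hident : σ.restrict U' = (tm.withDensity fun t => (D t : ℝ≥0∞)).restrict U' :=
    restrict_eq_restrict_of_forall_isOpen hσU' hopen'
  refine ⟨U', hU'o, ht₀U', A₀, hA₀m, hA₀0, hA₀top, fun V hVm hVU' hVreg hVfree => ?_⟩
  have hσV : σ V = ∫⁻ t in V, (D t : ℝ≥0∞) ∂tm := by
    have h1 : σ V = σ.restrict U' V := by rw [Measure.restrict_apply hVm, inter_eq_left.2 hVU']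
    rw [h1, hident, Measure.restrict_apply hVm, inter_eq_left.2 hVU', withDensity_apply _ hVm]
  rw [htube A₀ hA₀m V hVm hVreg hVfree, hσV]

/-! ## §3 The local socket from the identity on a DISJOINT COVERING FAMILY (cosets) -/

set_option maxHeartbeats 3200000 in
set_option synthInstance.maxHeartbeats 200000 in
-- as §1
/-- **(J1)(b) «COSET REDUCTION», covering-family form**: the local tube-Jacobian socket `hJacLoc` of ★ p851645 FOLLOWS from the tube identity on an ARBITRARY
family `𝒞` of measurable subsets of `T` such that every OPEN `O ⊆ U` is a countable union of pairwise DISJOINT members of `𝒞` (level cosets `s·T_j` of the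
congruence filtration: nested-or-disjoint, and a clopen basis of the locally profinite `T` — (J2)∕(J6) supply that).  Proof: as §2 after summing the identity over the
disjoint cover (σ-additivity of `σ` from §1 and of `D · tm`; every member of a cover of an open `O ⊆ U′` lies in the `W`-free regular `U′`).
[cite: HarishChandra1970, Lemma 22] [cite: Weil1965, n° 49 Lemme 22 (p. 70)] [cite: Rogawski1990, §12.5 p. 182] -/
theorem tubeJacobianLocal_of_cover
    (hns : ∀ w : PlacesOver L v, IsCMField.complexConj L • w.1 = w.1)
    [MeasurableSpace ↥(unitaryGroupOfForm (conjLocal L (IsCMField.complexConj L) v) (cmLocalForm L 3 v))] [BorelSpace ↥(unitaryGroupOfForm (conjLocal L (IsCMField.complexConj L) v) (cmLocalForm L 3 v))] [LocallyCompactSpace ↥(unitaryGroupOfForm (conjLocal L (IsCMField.complexConj L) v) (cmLocalForm L 3 v))] [SecondCountableTopology ↥(unitaryGroupOfForm (conjLocal L (IsCMField.complexConj L) v) (cmLocalForm L 3 v))] [T2Space ↥(unitaryGroupOfForm (conjLocal L (IsCMField.complexConj L) v) (cmLocalForm L 3 v))]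
    [MeasurableSpace (↥(unitaryGroupOfForm (conjLocal L (IsCMField.complexConj L) v) (cmLocalForm L 3 v)) ⧸ (cmBorelTriple L 3 v).M)] [BorelSpace (↥(unitaryGroupOfForm (conjLocal L (IsCMField.complexConj L) v) (cmLocalForm L 3 v)) ⧸ (cmBorelTriple L 3 v).M)]
    (ν : Measure ↥(unitaryGroupOfForm (conjLocal L (IsCMField.complexConj L) v) (cmLocalForm L 3 v))) [ν.IsHaarMeasure] [ν.IsMulRightInvariant]
    (tm : Measure ↥(cmBorelTriple L 3 v).M) [tm.IsMulLeftInvariant] [IsFiniteMeasureOnCompacts tm] [tm.IsOpenPosMeasure] [tm.IsInvInvariant]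
    (Φ : (↥(unitaryGroupOfForm (conjLocal L (IsCMField.complexConj L) v) (cmLocalForm L 3 v)) ⧸ (cmBorelTriple L 3 v).M) × ↥(cmBorelTriple L 3 v).M → ↥(unitaryGroupOfForm (conjLocal L (IsCMField.complexConj L) v) (cmLocalForm L 3 v))) (hΦ : ∀ (x : ↥(unitaryGroupOfForm (conjLocal L (IsCMField.complexConj L) v) (cmLocalForm L 3 v))) (t : ↥(cmBorelTriple L 3 v).M), Φ (QuotientGroup.mk x, t) = x * t * x⁻¹)
    (w : ↥(unitaryGroupOfForm (conjLocal L (IsCMField.complexConj L) v) (cmLocalForm L 3 v))) (hw : Units.val (w : GL (Fin 3) (LocalRing L v)) = cmLocalForm L 3 v)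
    (D : ↥(cmBorelTriple L 3 v).M → ℝ≥0)
    (hJacCov : ∀ t₀ : ↥(cmBorelTriple L 3 v).M, IsRegularElt (((t₀ : ↥(unitaryGroupOfForm (conjLocal L (IsCMField.complexConj L) v) (cmLocalForm L 3 v)))) : GL (Fin 3) (LocalRing L v)) →
      ∃ U : Set ↥(cmBorelTriple L 3 v).M, IsOpen U ∧ t₀ ∈ U ∧
        ∃ A₀ : Set (↥(unitaryGroupOfForm (conjLocal L (IsCMField.complexConj L) v) (cmLocalForm L 3 v)) ⧸ (cmBorelTriple L 3 v).M), MeasurableSet A₀ ∧ (quotientMeasure (cmBorelTriple L 3 v).M tm (isClosed_cmBorelTriple_M L v) ν) A₀ ≠ 0 ∧ (quotientMeasure (cmBorelTriple L 3 v).M tm (isClosed_cmBorelTriple_M L v) ν) A₀ ≠ ∞ ∧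
          ∃ 𝒞 : Set (Set ↥(cmBorelTriple L 3 v).M), (∀ C ∈ 𝒞, MeasurableSet C) ∧
            (∀ O : Set ↥(cmBorelTriple L 3 v).M, IsOpen O → O ⊆ U → ∃ 𝒟 : Set (Set ↥(cmBorelTriple L 3 v).M), 𝒟 ⊆ 𝒞 ∧ 𝒟.Countable ∧ 𝒟.Pairwise Disjoint ∧ ⋃₀ 𝒟 = O) ∧
            ∀ C ∈ 𝒞, C ⊆ U → ν (Φ '' (A₀ ×ˢ C)) = (quotientMeasure (cmBorelTriple L 3 v).M tm (isClosed_cmBorelTriple_M L v) ν) A₀ * ∫⁻ t in C, (D t : ℝ≥0∞) ∂tm) :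
    ∀ t₀ : ↥(cmBorelTriple L 3 v).M, IsRegularElt (((t₀ : ↥(unitaryGroupOfForm (conjLocal L (IsCMField.complexConj L) v) (cmLocalForm L 3 v)))) : GL (Fin 3) (LocalRing L v)) →
      ∃ U : Set ↥(cmBorelTriple L 3 v).M, IsOpen U ∧ t₀ ∈ U ∧
        ∃ A₀ : Set (↥(unitaryGroupOfForm (conjLocal L (IsCMField.complexConj L) v) (cmLocalForm L 3 v)) ⧸ (cmBorelTriple L 3 v).M), MeasurableSet A₀ ∧ (quotientMeasure (cmBorelTriple L 3 v).M tm (isClosed_cmBorelTriple_M L v) ν) A₀ ≠ 0 ∧ (quotientMeasure (cmBorelTriple L 3 v).M tm (isClosed_cmBorelTriple_M L v) ν) A₀ ≠ ∞ ∧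
          ∀ V : Set ↥(cmBorelTriple L 3 v).M, MeasurableSet V → V ⊆ U → (∀ t ∈ V, IsRegularElt (((t : ↥(unitaryGroupOfForm (conjLocal L (IsCMField.complexConj L) v) (cmLocalForm L 3 v)))) : GL (Fin 3) (LocalRing L v))) →
            (∀ t ∈ V, ∀ t' ∈ V, ((t' : ↥(cmBorelTriple L 3 v).M) : ↥(unitaryGroupOfForm (conjLocal L (IsCMField.complexConj L) v) (cmLocalForm L 3 v))) ≠ w * t * w⁻¹) →
              ν (Φ '' (A₀ ×ˢ V)) = (quotientMeasure (cmBorelTriple L 3 v).M tm (isClosed_cmBorelTriple_M L v) ν) A₀ * ∫⁻ t in V, (D t : ℝ≥0∞) ∂tm := by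
  classical
  obtain ⟨σ, hσfin, hσsf, hσcar, -, htube⟩ := exists_radialMeasure_tube L v hns ν tm Φ hΦ w hw
  haveI := hσfin
  haveI : Nontrivial (LocalRing L v) := UnitaryGroup.nontrivial_localRing L v
  have hR : ∀ x : LocalRing L v, x ≠ 0 → IsUnit x := isUnit_of_ne_zero_of_nonsplit L v hns
  have hJ : cmLocalForm L 3 v = (StdForm.antidiagonal 3).over (LocalRing L v) := cmLocalForm_eq_over L 3 v
  have hT := isClosed_cmBorelTriple_M L v
  have hSo : IsOpen {t : ↥(cmBorelTriple L 3 v).M | IsRegularElt (((t : ↥(unitaryGroupOfForm (conjLocal L (IsCMField.complexConj L) v) (cmLocalForm L 3 v)))) : GL (Fin 3) (LocalRing L v))} :=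
    isOpen_setOf_isRegularElt_torusU (conjLocal L (IsCMField.complexConj L) v) (cmLocalForm L 3 v) hR
  refine tubeJacobianLocal_of_open L v hns ν tm Φ hΦ w hw D fun t₀ ht₀ => ?_
  obtain ⟨U, hUo, ht₀U, A₀, hA₀m, hA₀0, hA₀top, 𝒞, h𝒞m, hcov, hid⟩ := hJacCov t₀ ht₀
  -- a `W`-free regular open neighbourhood `U′ ⊆ U` of `t₀` (★ p849811 §e)
  have hne : (t₀ : ↥(unitaryGroupOfForm (conjLocal L (IsCMField.complexConj L) v) (cmLocalForm L 3 v))) ≠ w * t₀ * w⁻¹ := by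
    intro h
    apply weyl_not_mem_torusU (conjLocal L (IsCMField.complexConj L) v) hJ hw
    have hwZ : w ∈ Subgroup.centralizer ({(t₀ : ↥(unitaryGroupOfForm (conjLocal L (IsCMField.complexConj L) v) (cmLocalForm L 3 v)))} : Set ↥(unitaryGroupOfForm (conjLocal L (IsCMField.complexConj L) v) (cmLocalForm L 3 v))) := by
      rw [Subgroup.mem_centralizer_iff]
      intro g hg
      rw [mem_singleton_iff.1 hg]
      exact (mul_inv_eq_iff_eq_mul.1 h.symm).symm
    rw [centralizer_eq_cmTorus_of_isRegularElt L v t₀.2 ht₀] at hwZ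
    exact hwZ
  obtain ⟨O₁, O₂, hO₁, hO₂, h₁, h₂, hdisj⟩ := t2_separation hne
  have hcont : Continuous fun t : ↥(cmBorelTriple L 3 v).M => w * (t : ↥(unitaryGroupOfForm (conjLocal L (IsCMField.complexConj L) v) (cmLocalForm L 3 v))) * w⁻¹ := (continuous_const.mul continuous_subtype_val).mul continuous_const
  set U' : Set ↥(cmBorelTriple L 3 v).M := U ∩ ({t | (t : ↥(unitaryGroupOfForm (conjLocal L (IsCMField.complexConj L) v) (cmLocalForm L 3 v))) ∈ O₁ ∧ w * (t : ↥(unitaryGroupOfForm (conjLocal L (IsCMField.complexConj L) v) (cmLocalForm L 3 v))) * w⁻¹ ∈ O₂} ∩ {t : ↥(cmBorelTriple L 3 v).M | IsRegularElt (((t : ↥(unitaryGroupOfForm (conjLocal L (IsCMField.complexConj L) v) (cmLocalForm L 3 v)))) : GL (Fin 3) (LocalRing L v))}) with hU'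
  have hWo : IsOpen {t : ↥(cmBorelTriple L 3 v).M | (t : ↥(unitaryGroupOfForm (conjLocal L (IsCMField.complexConj L) v) (cmLocalForm L 3 v))) ∈ O₁ ∧ w * (t : ↥(unitaryGroupOfForm (conjLocal L (IsCMField.complexConj L) v) (cmLocalForm L 3 v))) * w⁻¹ ∈ O₂} := (hO₁.preimage continuous_subtype_val).inter (hO₂.preimage hcont)
  have hU'o : IsOpen U' := hUo.inter (hWo.inter hSo)
  have ht₀U' : t₀ ∈ U' := ⟨ht₀U, ⟨h₁, h₂⟩, ht₀⟩
  have hU'U : U' ⊆ U := fun t ht => ht.1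
  have hU'reg : ∀ t ∈ U', IsRegularElt (((t : ↥(unitaryGroupOfForm (conjLocal L (IsCMField.complexConj L) v) (cmLocalForm L 3 v)))) : GL (Fin 3) (LocalRing L v)) := fun t ht => ht.2.2
  have hU'free : ∀ t ∈ U', ∀ t' ∈ U', ((t' : ↥(cmBorelTriple L 3 v).M) : ↥(unitaryGroupOfForm (conjLocal L (IsCMField.complexConj L) v) (cmLocalForm L 3 v))) ≠ w * t * w⁻¹ := fun t ht t' ht' h => hdisj.ne_of_mem ht'.2.1.1 ht.2.1.2 h
  refine ⟨U', hU'o, ht₀U', A₀, hA₀m, hA₀0, hA₀top, fun O hO hOU' => ?_⟩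
  -- sum the identity over a disjoint countable cover of `O` by members of `𝒞`
  obtain ⟨𝒟, h𝒟𝒞, h𝒟c, h𝒟d, h𝒟U⟩ := hcov O hO (hOU'.trans hU'U)
  have h𝒟m : ∀ C ∈ 𝒟, MeasurableSet C := fun C hC => h𝒞m C (h𝒟𝒞 hC)
  have hCO : ∀ C ∈ 𝒟, C ⊆ O := fun C hC x hx => h𝒟U ▸ mem_sUnion_of_mem hx hC
  have h1 : σ O = ∑' C : 𝒟, σ C := measure_eq_tsum_of_sUnion_eq σ h𝒟c h𝒟d h𝒟m h𝒟U
  have h2 : (tm.withDensity fun t => (D t : ℝ≥0∞)) O = ∑' C : 𝒟, (tm.withDensity fun t => (D t : ℝ≥0∞)) C :=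
    measure_eq_tsum_of_sUnion_eq _ h𝒟c h𝒟d h𝒟m h𝒟U
  have h3 : ∀ C : 𝒟, (quotientMeasure (cmBorelTriple L 3 v).M tm (isClosed_cmBorelTriple_M L v) ν) A₀ * σ C = (quotientMeasure (cmBorelTriple L 3 v).M tm (isClosed_cmBorelTriple_M L v) ν) A₀ * (tm.withDensity fun t => (D t : ℝ≥0∞)) C := by
    rintro ⟨C, hC⟩
    have hCU' : C ⊆ U' := (hCO C hC).trans hOU'
    rw [← htube A₀ hA₀m C (h𝒟m C hC) (fun t ht => hU'reg t (hCU' ht)) (fun t ht t' ht' => hU'free t (hCU' ht) t' (hCU' ht')),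
      withDensity_apply _ (h𝒟m C hC)]
    exact hid C (h𝒟𝒞 hC) (hCU'.trans hU'U)
  rw [htube A₀ hA₀m O hO.measurableSet (fun t ht => hU'reg t (hOU' ht)) (fun t ht t' ht' => hU'free t (hOU' ht) t' (hOU' ht')),
    ← withDensity_apply _ hO.measurableSet, h1, h2, ← ENNReal.tsum_mul_left, ← ENNReal.tsum_mul_left]
  exact tsum_congr h3

/-! ## §4 The local socket from the identity on a π-SYSTEM containing the (regular, `W`-free, relatively compact) `U` -/

set_option maxHeartbeats 3200000 in
set_option synthInstance.maxHeartbeats 200000 in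
-- as §1
/-- **(J1)(b) «COSET REDUCTION», π-system form** (the memo's wording: «the cosets `s′T_γ′ ⊆ U` form a π-system generating Borel(`U`)»): the local tube-Jacobian socket
`hJacLoc` of ★ p851645 FOLLOWS from the tube identity on the members of a π-system `𝒞` of measurable subsets of a relatively compact, REGULAR, `W`-FREE open `U ∋ t₀` WITH
`U ∈ 𝒞`, such that every open `O ⊆ U` is measurable for the σ-algebra generated by `𝒞` (e.g. a countable union of members).  Proof: by §1 the identity on `C ∈ 𝒞` reads
`σ(C) = ∫⁻_C D dtm`; `σ|_U` is finite (`U` relatively compact); uniqueness on the generated σ-algebra (`ext_on_measurableSpace_of_generate_finite`, the total masses agree because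
`U ∈ 𝒞`), which contains `V ∩ U` for every Borel `V` (`measurableSet_generateFrom_inter_of_open`); then §1 for any measurable regular `W`-free `V ⊆ U`.  (J6) picks `U = t₀·T_γ`
inside `exists_isOpen_regular_wfree_nhds`.) [cite: HarishChandra1970, Lemma 22] [cite: Weil1965, n° 49 Lemme 22 (p. 70)] [cite: Rogawski1990, §12.5 p. 182] -/
theorem tubeJacobianLocal_of_piSystem
    (hns : ∀ w : PlacesOver L v, IsCMField.complexConj L • w.1 = w.1)
    [MeasurableSpace ↥(unitaryGroupOfForm (conjLocal L (IsCMField.complexConj L) v) (cmLocalForm L 3 v))] [BorelSpace ↥(unitaryGroupOfForm (conjLocal L (IsCMField.complexConj L) v) (cmLocalForm L 3 v))] [LocallyCompactSpace ↥(unitaryGroupOfForm (conjLocal L (IsCMField.complexConj L) v) (cmLocalForm L 3 v))] [SecondCountableTopology ↥(unitaryGroupOfForm (conjLocal L (IsCMField.complexConj L) v) (cmLocalForm L 3 v))] [T2Space ↥(unitaryGroupOfForm (conjLocal L (IsCMField.complexConj L) v) (cmLocalForm L 3 v))]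
    [MeasurableSpace (↥(unitaryGroupOfForm (conjLocal L (IsCMField.complexConj L) v) (cmLocalForm L 3 v)) ⧸ (cmBorelTriple L 3 v).M)] [BorelSpace (↥(unitaryGroupOfForm (conjLocal L (IsCMField.complexConj L) v) (cmLocalForm L 3 v)) ⧸ (cmBorelTriple L 3 v).M)]
    (ν : Measure ↥(unitaryGroupOfForm (conjLocal L (IsCMField.complexConj L) v) (cmLocalForm L 3 v))) [ν.IsHaarMeasure] [ν.IsMulRightInvariant]
    (tm : Measure ↥(cmBorelTriple L 3 v).M) [tm.IsMulLeftInvariant] [IsFiniteMeasureOnCompacts tm] [tm.IsOpenPosMeasure] [tm.IsInvInvariant]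
    (Φ : (↥(unitaryGroupOfForm (conjLocal L (IsCMField.complexConj L) v) (cmLocalForm L 3 v)) ⧸ (cmBorelTriple L 3 v).M) × ↥(cmBorelTriple L 3 v).M → ↥(unitaryGroupOfForm (conjLocal L (IsCMField.complexConj L) v) (cmLocalForm L 3 v))) (hΦ : ∀ (x : ↥(unitaryGroupOfForm (conjLocal L (IsCMField.complexConj L) v) (cmLocalForm L 3 v))) (t : ↥(cmBorelTriple L 3 v).M), Φ (QuotientGroup.mk x, t) = x * t * x⁻¹)
    (w : ↥(unitaryGroupOfForm (conjLocal L (IsCMField.complexConj L) v) (cmLocalForm L 3 v))) (hw : Units.val (w : GL (Fin 3) (LocalRing L v)) = cmLocalForm L 3 v)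
    (D : ↥(cmBorelTriple L 3 v).M → ℝ≥0)
    (hJacPi : ∀ t₀ : ↥(cmBorelTriple L 3 v).M, IsRegularElt (((t₀ : ↥(unitaryGroupOfForm (conjLocal L (IsCMField.complexConj L) v) (cmLocalForm L 3 v)))) : GL (Fin 3) (LocalRing L v)) →
      ∃ U : Set ↥(cmBorelTriple L 3 v).M, IsOpen U ∧ t₀ ∈ U ∧ IsCompact (closure U) ∧
        (∀ t ∈ U, IsRegularElt (((t : ↥(unitaryGroupOfForm (conjLocal L (IsCMField.complexConj L) v) (cmLocalForm L 3 v)))) : GL (Fin 3) (LocalRing L v))) ∧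
        (∀ t ∈ U, ∀ t' ∈ U, ((t' : ↥(cmBorelTriple L 3 v).M) : ↥(unitaryGroupOfForm (conjLocal L (IsCMField.complexConj L) v) (cmLocalForm L 3 v))) ≠ w * t * w⁻¹) ∧
        ∃ A₀ : Set (↥(unitaryGroupOfForm (conjLocal L (IsCMField.complexConj L) v) (cmLocalForm L 3 v)) ⧸ (cmBorelTriple L 3 v).M), MeasurableSet A₀ ∧ (quotientMeasure (cmBorelTriple L 3 v).M tm (isClosed_cmBorelTriple_M L v) ν) A₀ ≠ 0 ∧ (quotientMeasure (cmBorelTriple L 3 v).M tm (isClosed_cmBorelTriple_M L v) ν) A₀ ≠ ∞ ∧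
          ∃ 𝒞 : Set (Set ↥(cmBorelTriple L 3 v).M), U ∈ 𝒞 ∧ (∀ C ∈ 𝒞, MeasurableSet C ∧ C ⊆ U) ∧ IsPiSystem 𝒞 ∧
            (∀ O : Set ↥(cmBorelTriple L 3 v).M, IsOpen O → O ⊆ U → MeasurableSet[MeasurableSpace.generateFrom 𝒞] O) ∧
            ∀ C ∈ 𝒞, ν (Φ '' (A₀ ×ˢ C)) = (quotientMeasure (cmBorelTriple L 3 v).M tm (isClosed_cmBorelTriple_M L v) ν) A₀ * ∫⁻ t in C, (D t : ℝ≥0∞) ∂tm) :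
    ∀ t₀ : ↥(cmBorelTriple L 3 v).M, IsRegularElt (((t₀ : ↥(unitaryGroupOfForm (conjLocal L (IsCMField.complexConj L) v) (cmLocalForm L 3 v)))) : GL (Fin 3) (LocalRing L v)) →
      ∃ U : Set ↥(cmBorelTriple L 3 v).M, IsOpen U ∧ t₀ ∈ U ∧
        ∃ A₀ : Set (↥(unitaryGroupOfForm (conjLocal L (IsCMField.complexConj L) v) (cmLocalForm L 3 v)) ⧸ (cmBorelTriple L 3 v).M), MeasurableSet A₀ ∧ (quotientMeasure (cmBorelTriple L 3 v).M tm (isClosed_cmBorelTriple_M L v) ν) A₀ ≠ 0 ∧ (quotientMeasure (cmBorelTriple L 3 v).M tm (isClosed_cmBorelTriple_M L v) ν) A₀ ≠ ∞ ∧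
          ∀ V : Set ↥(cmBorelTriple L 3 v).M, MeasurableSet V → V ⊆ U → (∀ t ∈ V, IsRegularElt (((t : ↥(unitaryGroupOfForm (conjLocal L (IsCMField.complexConj L) v) (cmLocalForm L 3 v)))) : GL (Fin 3) (LocalRing L v))) →
            (∀ t ∈ V, ∀ t' ∈ V, ((t' : ↥(cmBorelTriple L 3 v).M) : ↥(unitaryGroupOfForm (conjLocal L (IsCMField.complexConj L) v) (cmLocalForm L 3 v))) ≠ w * t * w⁻¹) →
              ν (Φ '' (A₀ ×ˢ V)) = (quotientMeasure (cmBorelTriple L 3 v).M tm (isClosed_cmBorelTriple_M L v) ν) A₀ * ∫⁻ t in V, (D t : ℝ≥0∞) ∂tm := by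
  classical
  obtain ⟨σ, hσfin, hσsf, hσcar, -, htube⟩ := exists_radialMeasure_tube L v hns ν tm Φ hΦ w hw
  haveI := hσfin
  intro t₀ ht₀
  obtain ⟨U, hUo, ht₀U, hUK, hUreg, hUfree, A₀, hA₀m, hA₀0, hA₀top, 𝒞, hU𝒞, h𝒞, hπ, hgen, hid⟩ := hJacPi t₀ ht₀
  refine ⟨U, hUo, ht₀U, A₀, hA₀m, hA₀0, hA₀top, fun V hVm hVU hVreg hVfree => ?_⟩
  -- `σ = D · tm` on the members of `𝒞`
  have hC : ∀ C ∈ 𝒞, σ.restrict U C = (tm.withDensity fun t => (D t : ℝ≥0∞)).restrict U C := by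
    intro C hC𝒞
    obtain ⟨hCm, hCU⟩ := h𝒞 C hC𝒞
    have h1 := htube A₀ hA₀m C hCm (fun t ht => hUreg t (hCU ht)) (fun t ht t' ht' => hUfree t (hCU ht) t' (hCU ht'))
    have h2 := hid C hC𝒞
    rw [h1] at h2
    rw [Measure.restrict_apply hCm, Measure.restrict_apply hCm, inter_eq_left.2 hCU, withDensity_apply _ hCm]
    exact (ENNReal.mul_right_inj hA₀0 hA₀top).1 h2
  have hσU : σ U ≠ ∞ := ((measure_mono subset_closure).trans_lt hUK.measure_lt_top).ne
  haveI : IsFiniteMeasure (σ.restrict U) := ⟨by rw [Measure.restrict_apply_univ]; exact hσU.lt_top⟩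
  have hle : MeasurableSpace.generateFrom 𝒞 ≤ (inferInstance : MeasurableSpace ↥(cmBorelTriple L 3 v).M) :=
    MeasurableSpace.generateFrom_le fun C hC => (h𝒞 C hC).1
  have huniv : σ.restrict U univ = (tm.withDensity fun t => (D t : ℝ≥0∞)).restrict U univ := by
    have h := hC U hU𝒞
    rwa [Measure.restrict_apply hUo.measurableSet, Measure.restrict_apply hUo.measurableSet, inter_self,
      ← Measure.restrict_apply_univ (μ := σ), ← Measure.restrict_apply_univ (μ := tm.withDensity fun t => (D t : ℝ≥0∞))] at h
  have hVgen : MeasurableSet[MeasurableSpace.generateFrom 𝒞] (V ∩ U) := measurableSet_generateFrom_inter_of_open hUo 𝒞 hgen hVm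
  have hext := ext_on_measurableSpace_of_generate_finite (inferInstance : MeasurableSpace ↥(cmBorelTriple L 3 v).M) 𝒞 hC hle rfl hπ huniv hVgen
  rw [inter_eq_left.2 hVU, Measure.restrict_apply hVm, Measure.restrict_apply hVm, inter_eq_left.2 hVU, withDensity_apply _ hVm] at hext
  rw [htube A₀ hA₀m V hVm hVreg hVfree, hext]

end CM

end Summit.HodgeConjecture.HodgeConjecture.Cruxes.H413.F0P3cStCharTSWeylHypTubeReduction

end
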